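import Mathlib.Analysis.Calculus.ParametricIntegral
import Literature.MathematicalPhysics.QuantumLattice.SpectralProjectionDerivProofs
import Literature.MathematicalPhysics.QuantumLattice.SpectralFilterProofs
import Literature.MathematicalPhysics.QuantumLattice.DuhamelTwoPointProofs
import HarnessLib

/-!
# Hastings' equation for gapped spectral projections: `∂_s P(s) = i[D(s), P(s)]`

Ninth file of the formalisation of the Michalakis–Zwolak stability theorem (hubbard.S19); together
with `SpectralProjectionDerivProofs` it completes the projection-level statement of Hastings'
quasi-adiabatic continuation for the affine path `H_s = H₀ + sX`:

* **Fourier representation of spectral projections.** For a Schwartz function `ψ`,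
  `(∫ (𝓕⁻ψ)(t) • e^{itH} dt) uₖ = ψ(−Eₖ/(2π)) uₖ` (`integral_fourierInv_smul_exp_mulVec`); hence a
  weighted time average `∫ w(t) • e^{itH} dt` whose Fourier transform is `𝟙` on a spectral cluster
  and `0` on the rest IS the spectral projection (`integral_smul_exp_eq_projMatrix`), and a smooth
  cut-off with these values exists as soon as the cluster is separated by a gap
  (`exists_schwartz_cutoff`, a bump function in the Fourier variable).
* **Differentiability** of `s ↦ ∫ w(t) • e^{it(H₀+sX)} dt` for weights with an integrable first
  moment, by differentiation under the integral sign with the Duhamel formula for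
  `∂_s e^{it(H₀+sX)}` (`Matrix.hasDerivAt_exp_add_smul` of `DuhamelTwoPointProofs`) and the bound
  `‖∂_s e^{itH_s}‖ ≤ |t| ‖X‖` (`hasDerivAt_integral_smul_exp_affine`).
* **Hastings' equation** (`hasDerivAt_clusterProj`): if on a neighbourhood of `s₀` the spectrum
  of `H_s` avoids the window `(a', b')` (`b' − a' ≥ γ > 0`), the cluster projection
  `P(s)` onto the eigenvalues `≤ a'` is differentiable at `s₀` and
  `P'(s₀) = i[D, P(s₀)]`, `D = ∫ W(t) e^{itH_{s₀}} X e^{−itH_{s₀}} dt`, for every admissible weight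
  `W` (`exists_spectralFlowWeight`); the value of the derivative comes from
  `hasDerivAt_proj_eq_comm_hastingsGenerator`.

Sources: Bachmann–Michalakis–Nachtergaele–Sims, CMP **309** (2012) 835 = arXiv:1102.0842, §2
(Proposition 2.4: the generator `D(s)` satisfies `∂_s P(s) = i[D(s), P(s)]`); Hastings–Wen, PRB
**72** (2005) 045141 (quasi-adiabatic continuation); used in Michalakis–Zwolak, arXiv:1109.1588
§5.2 ("the quasi-adiabatic evolution `U(s)`"). No definitions, no named facts (theorems only).
-/

noncomputable section

open Matrix Complex NormedSpace MeasureTheory Finset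
open scoped Matrix.Norms.L2Operator _root_.Topology

namespace Literature.MathematicalPhysics.QuantumLattice

section Fourier

variable {n : Type*} [Fintype n] [DecidableEq n]

open SchwartzMap Real FourierTransform
open scoped FourierTransform

/-- The matrix-vector product with a fixed vector commutes with the Bochner integral. [folklore] -/
theorem integral_mulVec_comm (v : n → ℂ) {f : ℝ → Matrix n n ℂ} (hf : Integrable f) :
    (∫ t : ℝ, f t) *ᵥ v = ∫ t : ℝ, f t *ᵥ v := by
  let L : Matrix n n ℂ →ₗ[ℂ] (n → ℂ) :=
    { toFun := fun M => M *ᵥ v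
      map_add' := fun M N => add_mulVec M N v
      map_smul' := fun c M => by simp only [smul_mulVec, RingHom.id_apply] }
  have h := ContinuousLinearMap.integral_comp_comm (LinearMap.toContinuousLinearMap L) hf
  exact h.symm

/-- A unitary matrix has operator norm `≤ 1`. [folklore] -/
theorem norm_le_one_of_mem_unitary' {U : Matrix n n ℂ} (hU : U ∈ unitary (Matrix n n ℂ)) :
    ‖U‖ ≤ 1 := by
  rcases subsingleton_or_nontrivial (Matrix n n ℂ) with h | h
  · rw [Subsingleton.elim U 0, norm_zero]; exact zero_le_one
  · exact (CStarRing.norm_of_mem_unitary hU).le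

/-- `‖e^{itH}‖ ≤ 1` for Hermitian `H`. [folklore] -/
theorem norm_exp_I_mul_smul_le_one {H : Matrix n n ℂ} (hH : H.IsHermitian) (t : ℝ) :
    ‖exp ((I * t) • H)‖ ≤ 1 :=
  norm_le_one_of_mem_unitary' (exp_smul_mem_unitary hH (by simp))

/-- `t ↦ e^{itH}` is continuous. [folklore] -/
theorem continuous_exp_I_mul_smul (H : Matrix n n ℂ) : Continuous fun t : ℝ => exp ((I * t) • H) := by
  letI : NormedAlgebra ℚ (Matrix n n ℂ) := .restrictScalars ℚ ℂ _
  have : (fun t : ℝ => exp ((I * t) • H)) = fun t : ℝ => exp (t • (I • H)) :=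
    funext fun t => exp_I_mul_smul H t
  rw [this]
  fun_prop

/-- `t ↦ w(t) • e^{itH}` is integrable for integrable `w` and Hermitian `H`. [folklore] -/
theorem integrable_smul_exp_I_mul_smul {H : Matrix n n ℂ} (hH : H.IsHermitian) {w : ℝ → ℂ}
    (hw : Integrable w) : Integrable fun t : ℝ => w t • exp ((I * t) • H) := by
  refine hw.norm.mono'
    (hw.aestronglyMeasurable.smul (continuous_exp_I_mul_smul H).aestronglyMeasurable)
    (Filter.Eventually.of_forall fun t => ?_)
  rw [norm_smul]
  exact mul_le_of_le_one_right (norm_nonneg _) (norm_exp_I_mul_smul_le_one hH t)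

/-- **Fourier representation on eigenvectors**: `(∫ w(t) • e^{itH} dt) uₖ = (∫ e^{itEₖ} w(t) dt) • uₖ`.
[folklore] -/
theorem integral_smul_exp_mulVec_eigenvectorBasis {H : Matrix n n ℂ} (hH : H.IsHermitian)
    {w : ℝ → ℂ} (hw : Integrable w) (k : n) :
    (∫ t : ℝ, w t • exp ((I * t) • H)) *ᵥ (hH.eigenvectorBasis k : n → ℂ) =
      (∫ t : ℝ, cexp (t * hH.eigenvalues k * I) * w t) • (hH.eigenvectorBasis k : n → ℂ) := by
  rw [integral_mulVec_comm _ (integrable_smul_exp_I_mul_smul hH hw), ← integral_smul_const]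
  refine integral_congr_ae (Filter.Eventually.of_forall fun t => ?_)
  dsimp only
  rw [smul_mulVec, exp_smul_mulVec_eigenvectorBasis hH (I * t) k, smul_smul]
  congr 1
  ring_nf

/-- **Fourier representation of a function of `H`**: for a Schwartz function `ψ`,
`(∫ (𝓕⁻ψ)(t) • e^{itH} dt) uₖ = ψ(−Eₖ/(2π)) • uₖ` (Fourier inversion on the spectrum).
[folklore] -/
theorem integral_fourierInv_smul_exp_mulVec (ψ : 𝓢(ℝ, ℂ)) {H : Matrix n n ℂ}
    (hH : H.IsHermitian) (k : n) :
    (∫ t : ℝ, (𝓕⁻ ψ) t • exp ((I * t) • H)) *ᵥ (hH.eigenvectorBasis k : n → ℂ) =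
      ψ (-hH.eigenvalues k / (2 * π)) • (hH.eigenvectorBasis k : n → ℂ) := by
  rw [integral_smul_exp_mulVec_eigenvectorBasis hH (𝓕⁻ ψ).integrable k,
    integral_cexp_mul_eq_fourier]
  congr 1
  rw [← fourier_coe, fourier_fourierInv_eq]

/-- **A weighted time average of `e^{itH}` that is a spectral projection.** If
`∫ e^{itEₖ} w(t) dt = 𝟙[k ∈ S]` for every eigenvalue `Eₖ` of the Hermitian `H`, then
`∫ w(t) • e^{itH} dt` is the orthogonal projection onto `span {uₖ | k ∈ S}`. [folklore] -/
theorem integral_smul_exp_eq_projMatrix {H : Matrix n n ℂ} (hH : H.IsHermitian) {w : ℝ → ℂ}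
    (hw : Integrable w) (S : Finset n)
    (hval : ∀ k, (∫ t : ℝ, cexp (t * hH.eigenvalues k * I) * w t) = if k ∈ S then 1 else 0) :
    ∫ t : ℝ, w t • exp ((I * t) • H) =
      projMatrix (Submodule.span ℂ (Set.range fun i : S => hH.eigenvectorBasis i)) := by
  rw [← sub_eq_zero]
  refine eq_zero_of_mulVec_eigenvectorBasis_eq_zero hH fun l => ?_
  rw [sub_mulVec, integral_smul_exp_mulVec_eigenvectorBasis hH hw l, hval l,
    projMatrix_span_mulVec_eigenvectorBasis hH S l]
  split_ifs <;> simp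

/-- **A smooth spectral cut-off.** For `−R < a' < b'` there is a Schwartz function `ψ` with
`ψ(−E/(2π)) = 1` for `−R − 1 ≤ E ≤ a'` and `ψ(−E/(2π)) = 0` for `E ≥ b'` (a bump function in the
Fourier variable `ξ = −E/(2π)`). [folklore] -/
theorem exists_schwartz_cutoff {a' b' R : ℝ} (hab : a' < b') (hR : -R < a') :
    ∃ ψ : 𝓢(ℝ, ℂ), (∀ E : ℝ, -R - 1 ≤ E → E ≤ a' → ψ (-E / (2 * π)) = 1) ∧
      (∀ E : ℝ, b' ≤ E → ψ (-E / (2 * π)) = 0) := by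
  have hπ : (0 : ℝ) < 2 * π := by positivity
  set rIn : ℝ := (R + 1 + a') / (4 * π) with hrIn
  set c₀ : ℝ := rIn - a' / (2 * π) with hc₀
  have hrIn0 : 0 < rIn := by rw [hrIn]; exact div_pos (by linarith) (by positivity)
  have hlt : rIn < rIn + (b' - a') / (2 * π) := lt_add_of_pos_right _ (div_pos (by linarith) hπ)
  let b : ContDiffBump c₀ := ⟨rIn, rIn + (b' - a') / (2 * π), hrIn0, hlt⟩
  let φ : ℝ → ℂ := fun ξ => ((b ξ : ℝ) : ℂ)
  have hφs : HasCompactSupport φ := b.hasCompactSupport.comp_left Complex.ofReal_zero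
  have hφd : ContDiff ℝ (⊤ : ℕ∞) φ := (Complex.ofRealCLM.contDiff.comp b.contDiff)
  refine ⟨hφs.toSchwartzMap hφd, fun E h1 h2 => ?_, fun E hE => ?_⟩
  · show ((b (-E / (2 * π)) : ℝ) : ℂ) = 1
    rw [b.one_of_mem_closedBall, Complex.ofReal_one]
    rw [Metric.mem_closedBall, Real.dist_eq, abs_le]
    constructor
    · -- `-rIn ≤ ξ - c₀`
      change -rIn ≤ -E / (2 * π) - c₀
      rw [hc₀]
      have : -E / (2 * π) ≥ -a' / (2 * π) := by
        apply div_le_div_of_nonneg_right _ hπ.le; linarith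
      have h3 : -E / (2 * π) - (rIn - a' / (2 * π)) = (-E / (2 * π) + a' / (2 * π)) - rIn := by ring
      rw [h3]
      have h4 : -E / (2 * π) + a' / (2 * π) = (a' - E) / (2 * π) := by ring
      rw [h4]
      have : 0 ≤ (a' - E) / (2 * π) := div_nonneg (by linarith) hπ.le
      linarith
    · -- `ξ - c₀ ≤ rIn`
      change -E / (2 * π) - c₀ ≤ rIn
      rw [hc₀, hrIn]
      rw [show -E / (2 * π) - ((R + 1 + a') / (4 * π) - a' / (2 * π)) =
        (-(2 * E) + 2 * a' - (R + 1 + a')) / (4 * π) by field_simp; ring]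
      rw [div_le_div_iff_of_pos_right (by positivity : (0 : ℝ) < 4 * π)]
      linarith
  · show ((b (-E / (2 * π)) : ℝ) : ℂ) = 0
    rw [b.zero_of_le_dist, Complex.ofReal_zero]
    show rIn + (b' - a') / (2 * π) ≤ dist (-E / (2 * π)) c₀
    rw [Real.dist_eq, abs_sub_comm, abs_of_nonneg]
    · rw [hc₀]
      rw [show rIn - a' / (2 * π) - -E / (2 * π) = rIn + (E - a') / (2 * π) by ring]
      have : (b' - a') / (2 * π) ≤ (E - a') / (2 * π) :=
        div_le_div_of_nonneg_right (by linarith) hπ.le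
      linarith
    · rw [hc₀]
      rw [show rIn - a' / (2 * π) - -E / (2 * π) = rIn + (E - a') / (2 * π) by ring]
      have : 0 ≤ (E - a') / (2 * π) := div_nonneg (by linarith) hπ.le
      linarith

/-- Spectral projections commute with the Hamiltonian: `H P_S = P_S H`. [folklore] -/
theorem mul_projMatrix_span_eigenvectorBasis_comm {H : Matrix n n ℂ} (hH : H.IsHermitian)
    (S : Finset n) :
    H * projMatrix (Submodule.span ℂ (Set.range fun i : S => hH.eigenvectorBasis i)) =
      projMatrix (Submodule.span ℂ (Set.range fun i : S => hH.eigenvectorBasis i)) * H := by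
  rw [← sub_eq_zero]
  refine eq_zero_of_mulVec_eigenvectorBasis_eq_zero hH fun l => ?_
  rw [sub_mulVec, ← mulVec_mulVec, ← mulVec_mulVec, projMatrix_span_mulVec_eigenvectorBasis hH S l,
    mulVec_eigenvectorBasis_coe hH l, mulVec_smul, projMatrix_span_mulVec_eigenvectorBasis hH S l]
  split_ifs with hl
  · rw [mulVec_eigenvectorBasis_coe hH l, sub_self]
  · rw [mulVec_zero, smul_zero, sub_self]

end Fourier

/-! ### Differentiability of `s ↦ ∫ w(t) • e^{it(H₀ + sX)} dt` -/

section Deriv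

variable {n : Type*} [Fintype n] [DecidableEq n]

/-- `e^{σ (itH)}` is unitary for real `σ`, `t` and Hermitian `H`. [folklore] -/
theorem exp_real_smul_I_mul_smul_mem_unitary {H : Matrix n n ℂ} (hH : H.IsHermitian) (σ t : ℝ) :
    exp (σ • ((I * t) • H)) ∈ unitary (Matrix n n ℂ) := by
  rw [← Complex.coe_smul, smul_smul]
  exact exp_smul_mem_unitary hH (by simp)

/-- The Duhamel derivative term is bounded by `‖Y‖` along a unitary group:
`‖∫₀¹ e^{σB} Y e^{(1−σ)B} dσ‖ ≤ ‖Y‖` when all `e^{σB}` are unitary. [folklore] -/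
theorem norm_duhamel_le {B Y : Matrix n n ℂ} (hB : ∀ σ : ℝ, exp (σ • B) ∈ unitary (Matrix n n ℂ)) :
    ‖∫ σ in (0:ℝ)..1, exp (σ • B) * Y * exp ((1 - σ) • B)‖ ≤ ‖Y‖ := by
  have h := intervalIntegral.norm_integral_le_of_norm_le_const (a := 0) (b := 1) (C := ‖Y‖)
    (f := fun σ : ℝ => exp (σ • B) * Y * exp ((1 - σ) • B)) fun σ _ => by
      rw [norm_unitary_mul_mul_unitary (hB σ) (hB (1 - σ)) Y]
  simpa using h

omit [Fintype n] [DecidableEq n] in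
/-- The exponent of the perturbed propagator is affine in `s`:
`it(H₀ + sX) = itH₀ + s • (itX)`. [folklore] -/
theorem I_mul_smul_affine (H₀ X : Matrix n n ℂ) (t s : ℝ) :
    (I * t) • (H₀ + s • X) = (I * t) • H₀ + s • ((I * t) • X) := by
  rw [smul_add, smul_comm]

/-- **Derivative of the perturbed propagator** `s ↦ e^{it(H₀ + sX)}` (Duhamel, from
`Matrix.hasDerivAt_exp_add_smul`). [folklore] -/
theorem hasDerivAt_exp_I_mul_smul_affine (H₀ X : Matrix n n ℂ) (t s₀ : ℝ) :
    HasDerivAt (fun s : ℝ => exp ((I * t) • (H₀ + s • X)))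
      (∫ σ in (0:ℝ)..1, exp (σ • ((I * t) • (H₀ + s₀ • X))) * ((I * t) • X) *
        exp ((1 - σ) • ((I * t) • (H₀ + s₀ • X)))) s₀ := by
  have h := Matrix.hasDerivAt_exp_add_smul ((I * t) • H₀) ((I * t) • X) s₀
  simp only [← I_mul_smul_affine] at h
  exact h

/-- **Differentiation under the integral sign** for `s ↦ ∫ w(t) • e^{it(H₀+sX)} dt`: for an
integrable weight with integrable first moment, the derivative is
`∫ w(t) • (∫₀¹ e^{σ it H_s} (itX) e^{(1−σ) it H_s} dσ) dt` (dominated convergence with the bound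
`‖∂_s e^{itH_s}‖ ≤ |t| ‖X‖`). [folklore] -/
theorem hasDerivAt_integral_smul_exp_affine {H₀ X : Matrix n n ℂ} (hH₀ : H₀.IsHermitian)
    (hX : X.IsHermitian) {w : ℝ → ℂ} (hw : Integrable w)
    (hw1 : Integrable fun t : ℝ => ‖t‖ * ‖w t‖) (s₀ : ℝ) :
    HasDerivAt (fun s : ℝ => ∫ t : ℝ, w t • exp ((I * t) • (H₀ + s • X)))
      (∫ t : ℝ, w t • ∫ σ in (0:ℝ)..1, exp (σ • ((I * t) • (H₀ + s₀ • X))) * ((I * t) • X) *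
        exp ((1 - σ) • ((I * t) • (H₀ + s₀ • X)))) s₀ := by
  letI : NormedAlgebra ℚ (Matrix n n ℂ) := .restrictScalars ℚ ℂ _
  set F : ℝ → ℝ → Matrix n n ℂ := fun s t => w t • exp ((I * t) • (H₀ + s • X)) with hF
  set F' : ℝ → ℝ → Matrix n n ℂ := fun s t => w t • ∫ σ in (0:ℝ)..1,
    exp (σ • ((I * t) • (H₀ + s • X))) * ((I * t) • X) * exp ((1 - σ) • ((I * t) • (H₀ + s • X)))
    with hF'
  have hHs : ∀ s : ℝ, (H₀ + s • X).IsHermitian := fun s =>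
    hH₀.add (hX.smul (IsSelfAdjoint.all s))
  -- measurability of `F s` (continuity in `t`)
  have hFmeas : ∀ s, AEStronglyMeasurable (F s) volume := fun s =>
    hw.aestronglyMeasurable.smul (continuous_exp_I_mul_smul (H₀ + s • X)).aestronglyMeasurable
  have hFint : Integrable (F s₀) := integrable_smul_exp_I_mul_smul (hHs s₀) hw
  -- measurability of `F' s₀` (continuity in `t` of the parametric interval integral)
  have hcontD : Continuous fun t : ℝ => ∫ σ in (0:ℝ)..1,
      exp (σ • ((I * t) • (H₀ + s₀ • X))) * ((I * t) • X) *
        exp ((1 - σ) • ((I * t) • (H₀ + s₀ • X))) := by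
    refine intervalIntegral.continuous_parametric_intervalIntegral_of_continuous' ?_ 0 1
    show Continuous fun p : ℝ × ℝ => exp (p.2 • ((I * (p.1 : ℂ)) • (H₀ + s₀ • X))) *
      ((I * (p.1 : ℂ)) • X) * exp ((1 - p.2) • ((I * (p.1 : ℂ)) • (H₀ + s₀ • X)))
    fun_prop
  have hF'meas : AEStronglyMeasurable (F' s₀) volume :=
    hw.aestronglyMeasurable.smul hcontD.aestronglyMeasurable
  -- the bound
  have hbound : ∀ᵐ t ∂volume, ∀ s ∈ (Set.univ : Set ℝ), ‖F' s t‖ ≤ ‖X‖ * (‖t‖ * ‖w t‖) := by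
    refine Filter.Eventually.of_forall fun t s _ => ?_
    rw [hF', norm_smul]
    have h1 := norm_duhamel_le (Y := (I * (t : ℂ)) • X)
      (exp_real_smul_I_mul_smul_mem_unitary (hHs s) · t)
    have h2 : ‖(I * (t : ℂ)) • X‖ = ‖t‖ * ‖X‖ := by
      rw [norm_smul, norm_mul, Complex.norm_I, one_mul, Complex.norm_real]
    calc ‖w t‖ * ‖∫ σ in (0:ℝ)..1, exp (σ • ((I * t) • (H₀ + s • X))) * ((I * t) • X) *
          exp ((1 - σ) • ((I * t) • (H₀ + s • X)))‖
        ≤ ‖w t‖ * (‖t‖ * ‖X‖) := mul_le_mul_of_nonneg_left (h1.trans_eq h2) (norm_nonneg _)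
      _ = ‖X‖ * (‖t‖ * ‖w t‖) := by ring
  have hdiff : ∀ᵐ t ∂volume, ∀ s ∈ (Set.univ : Set ℝ), HasDerivAt (F · t) (F' s t) s :=
    Filter.Eventually.of_forall fun t s _ => (hasDerivAt_exp_I_mul_smul_affine H₀ X t s).const_smul (w t)
  exact (hasDerivAt_integral_of_dominated_loc_of_deriv_le Filter.univ_mem
    (Filter.Eventually.of_forall hFmeas) hFint hF'meas hbound (hw1.const_mul ‖X‖) hdiff).2

end Deriv

/-! ### The cluster projection along the path and its derivative -/

section Cluster

variable {n : Type*} [Fintype n] [DecidableEq n]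

open SchwartzMap Real FourierTransform
open scoped FourierTransform

omit [Fintype n] [DecidableEq n] in
/-- Hermiticity along the affine path. [folklore] -/
theorem isHermitian_affinePath {H₀ X : Matrix n n ℂ} (hH₀ : H₀.IsHermitian)
    (hX : X.IsHermitian) (s : ℝ) : (H₀ + s • X).IsHermitian :=
  hH₀.add (hX.smul (IsSelfAdjoint.all s))

/-- **Hastings' equation for the cluster projection.** Let `H_s = H₀ + sX` (`H₀`, `X` Hermitian)
and suppose that for `s` in a neighbourhood `J` of `s₀` every eigenvalue of `H_s` is `≥ −R` and lies
outside the window `(a', b')`, where `−R < a'` and `b' − a' ≥ γ > 0`. Let `P(s)` be the spectral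
projection of `H_s` onto the eigenvalues `≤ a'` and `D = ∫ W(t) • τ_t^{H_{s₀}}(X) dt` for an
integrable weight with `∫ e^{itΔ} W = i/Δ` off the gap (`exists_spectralFlowWeight`). Then `P` is
differentiable at `s₀` with `P'(s₀) = i[D, P(s₀)]`.
Proof: `P(s) = ∫ (𝓕⁻ψ)(t) • e^{itH_s} dt` near `s₀` for a smooth cut-off `ψ`
(`integral_smul_exp_eq_projMatrix`, `exists_schwartz_cutoff`), which is differentiable in `s`
(`hasDerivAt_integral_smul_exp_affine`); the value of the derivative is identified by
`hasDerivAt_proj_eq_comm_hastingsGenerator`. Bachmann–Michalakis–Nachtergaele–Sims,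
arXiv:1102.0842, §2 Proposition 2.4; Hastings–Wen, PRB **72** (2005) 045141. [folklore] -/
theorem hasDerivAt_clusterProj {H₀ X : Matrix n n ℂ} (hH₀ : H₀.IsHermitian) (hX : X.IsHermitian)
    {a' b' R γ : ℝ} (hγ : 0 < γ) (hγab : γ ≤ b' - a') (hRa : -R < a')
    {J : Set ℝ} {s₀ : ℝ} (hJ : J ∈ 𝓝 s₀)
    (hspec : ∀ s ∈ J, ∀ k,
      ((isHermitian_affinePath hH₀ hX s).eigenvalues k ≤ a' ∨
        b' ≤ (isHermitian_affinePath hH₀ hX s).eigenvalues k) ∧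
      -R ≤ (isHermitian_affinePath hH₀ hX s).eigenvalues k)
    {W : ℝ → ℂ} (hWi : Integrable W)
    (hW : ∀ Δ : ℝ, γ ≤ |Δ| → ∫ t : ℝ, cexp (t * Δ * I) * W t = I / Δ) :
    HasDerivAt (fun s : ℝ => projMatrix (Submodule.span ℂ (Set.range fun i :
        ({k | (isHermitian_affinePath hH₀ hX s).eigenvalues k ≤ a'} : Finset n) =>
          (isHermitian_affinePath hH₀ hX s).eigenvectorBasis i)))
      (I • ((∫ t : ℝ, W t • heisenbergEvolution (H₀ + s₀ • X) t X) *
          projMatrix (Submodule.span ℂ (Set.range fun i :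
            ({k | (isHermitian_affinePath hH₀ hX s₀).eigenvalues k ≤ a'} : Finset n) =>
              (isHermitian_affinePath hH₀ hX s₀).eigenvectorBasis i)) -
        projMatrix (Submodule.span ℂ (Set.range fun i :
            ({k | (isHermitian_affinePath hH₀ hX s₀).eigenvalues k ≤ a'} : Finset n) =>
              (isHermitian_affinePath hH₀ hX s₀).eigenvectorBasis i)) *
          ∫ t : ℝ, W t • heisenbergEvolution (H₀ + s₀ • X) t X)) s₀ := by
  set hHs := isHermitian_affinePath hH₀ hX with hhHs
  set P : ℝ → Matrix n n ℂ := fun s => projMatrix (Submodule.span ℂ (Set.range fun i :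
    ({k | (hHs s).eigenvalues k ≤ a'} : Finset n) => (hHs s).eigenvectorBasis i)) with hP
  have hab : a' < b' := by linarith
  obtain ⟨ψ, hψ1, hψ0⟩ := exists_schwartz_cutoff hab hRa
  -- Fourier representation of `P` on `J`
  have hrep : ∀ s ∈ J, P s = ∫ t : ℝ, (𝓕⁻ ψ) t • exp ((I * t) • (H₀ + s • X)) := by
    intro s hs
    rw [hP]
    symm
    refine integral_smul_exp_eq_projMatrix (hHs s) (𝓕⁻ ψ).integrable _ fun k => ?_
    rw [integral_cexp_mul_eq_fourier, ← fourier_coe, fourier_fourierInv_eq]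
    obtain ⟨hk | hk, hkR⟩ := hspec s hs k
    · rw [if_pos (by simpa using hk)]
      exact hψ1 _ (by linarith) hk
    · rw [if_neg (by simp; linarith)]
      exact hψ0 _ hk
  -- differentiability
  have hmom : Integrable (fun t : ℝ => ‖t‖ * ‖(𝓕⁻ ψ) t‖) := by
    have h := (𝓕⁻ ψ).integrable_pow_mul volume 1
    simpa only [pow_one] using h
  have hG := hasDerivAt_integral_smul_exp_affine hH₀ hX (𝓕⁻ ψ).integrable hmom s₀
  have hPd := hG.congr_of_eventuallyEq (Filter.mem_of_superset hJ fun s hs => hrep s hs)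
  -- identify the derivative
  have hcomm : ∀ᶠ s : ℝ in 𝓝 s₀, (H₀ + s • X) * P s = P s * (H₀ + s • X) :=
    Filter.Eventually.of_forall fun s => mul_projMatrix_span_eigenvectorBasis_comm (hHs s) _
  have hidem : ∀ᶠ s : ℝ in 𝓝 s₀, P s * P s = P s :=
    Filter.Eventually.of_forall fun s => projMatrix_mul_self _
  have hsep : ∀ k ∈ ({k | (hHs s₀).eigenvalues k ≤ a'} : Finset n),
      ∀ l ∉ ({k | (hHs s₀).eigenvalues k ≤ a'} : Finset n),
        γ ≤ |(hHs s₀).eigenvalues k - (hHs s₀).eigenvalues l| := by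
    intro k hk l hl
    simp only [Finset.mem_filter, Finset.mem_univ, true_and, not_le] at hk hl
    obtain ⟨hl' | hl', -⟩ := hspec s₀ (mem_of_mem_nhds hJ) l
    · exact absurd hl' (not_le.mpr hl)
    · rw [abs_sub_comm, abs_of_nonneg (by linarith)]
      linarith
  have key := hasDerivAt_proj_eq_comm_hastingsGenerator hPd hcomm hidem (hHs s₀) _ rfl hγ hsep
    hWi hW
  rw [← key]
  exact hPd

end Cluster

end Literature.MathematicalPhysics.QuantumLattice
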